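import Summits.BirchSwinnertonDyer.BirchSwinnertonDyer.Theorems.PrintCFramBottomClassIndexLawFiveLeBernoulliKummerDictionary
import Summits.BirchSwinnertonDyer.BirchSwinnertonDyer.Theorems.PrintCFramBottomClassIndexLawFiveLeKrizLiBinders
import Summits.BirchSwinnertonDyer.BirchSwinnertonDyer.Theorems.PrintCFramBottomClassIndexLawFiveLeOffLocusResidue
import HarnessLib

/-!
# Crux `PrintCFram.BottomClassIndexLawFiveLe` (stmt-BirchSwinnertonDyer-20372), line `eisenstein-resource-bdp-line` (registry v18):
# THE KUMMER DICTIONARY ON THE CRUX'S BINDERS — for EVERY odd datum `(f, ψ, ω)` with the trace form `hss` (the quantifier shape of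
# B1 `stub_bsdp_of_classFactor` / B2′ `stub_bsdp_of_noAdmissibleHeegnerField`): `ψ(ℓ) = χ_e(ℓ)ω(ℓ)^k` at almost all primes, hence
# `p ∣ B_{1,ψ⁻¹} ⟺ p ∣ B_{p−k,χ_e}/(p−k)` and `p ∣ B_{1,ψε_Kω⁻¹} ⟺ p ∣ B_{k,χ_eε_K}/k`
# (cell `bsd-print-cfram`, width seat `bsd-line-cfram-p1-w8` g3; THEOREMS ONLY, `--supports` 20372; BSD is not proved by any of this)

HONEST FRAMING. Nothing here is a statement about BSD; no stub is closed; the registry is unchanged. Part I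
(`…BernoulliKummerDictionary`, p671810) translated the two Bernoulli numbers of the line for the EXPLICIT class character
`ψ_c = χ↑·(ω^k)↑` of `KrizLiBinders`. The registered stubs B1/B2′ quantify over an ARBITRARY odd datum `(f, ψ, ω)` with the trace
form `hss : a_ℓ(W) ≡ ψ(ℓ) + ψ⁻¹(ℓ)ω(ℓ)`. This file closes the gap: by the uniqueness of the Eisenstein pair (w3 g3
`EisensteinPair.eq_or_eq_of_traceForm_congr`) and parity (`ψ` odd, `ψ_c` odd, `ψ_c⁻¹ω` even), every such `ψ` AGREES WITH `ψ_c` at all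
integers prime to `p·m·f` (§2), so Part I's values-form dictionary applies verbatim (§3). With the class data
`(m, χ = χ_e, k ∈ {(p+1)/4, (3p−1)/4})` of `KrizLiBinders.exists_krizLiData_of_cmRamified`:

* B1's premise `‖bernoulliOnePrim ψ⁻¹‖ ≤ p⁻¹` ⟺ `‖B_{p−k,χ_e}/(p−k)‖ ≤ p⁻¹` (`norm_bernoulliOnePrim_inv_le_inv_iff_of_hss`; `χ_e`
  quadratic, so `χ_e⁻¹ = χ_e`);
* B2′'s premise at a field, `‖bernoulliOnePrim (bernoulliCharTwo ψ εK ω)‖ ≤ p⁻¹` ⟺ `‖B_{k,χε}/k‖ ≤ p⁻¹` for any primitive `χε` of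
  level prime to `p` agreeing with `χ_e·ε_K` at almost all primes (`norm_bernoulliOnePrim_bernoulliCharTwo_le_inv_iff_of_hss`), in
  particular at an imaginary quadratic `K''` Heegner for `N_W` with `ε_K` its Kronecker character (`p ∤ d_{K''}` is automatic:
  `p ∣ N_W` splits), `χε := (χ_e↑·ε_K↑)~` (`…_of_heegner`).
* §4 packages the existential form on the crux's binders (`W.HasCM`, `CMRamified W p`, `5 ≤ p`, odd `(f, ψ, ω)` with `hss`).

So, on this line, «`W` is a B1 member» reads `p ∣ B_{p−k,χ_e}/(p−k) = −L(1−(p−k), χ_e)` and «`K''` fails (4) for `W`» reads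
`p ∣ B_{p−k,χ_e}·B_{k,χ_{e}ε_{K''}}/(k(p−k))`, i.e. `p ∣ L(1+k−p, χ_e)·L(1−k, χ_e ε_{K''})` — generalized-Bernoulli / Cohen–Eisenstein
currency, the one of bsd-idea-7 g12's census engine and of the B2′ presearch (Wiles 2015, Byeon 2003).
beyond-print theorem: NO.

References: [KrizLi2019] §1.5 (1), §2, Thm. 1.20, §7.1 (`ψ ↔ ψ⁻¹ω`); [Washington1997] Thm. 5.11, Cor. 5.13, §5.1;
[LangCyclotomic1990] Ch. 2 Thm. 2.5; LEAD g10 report `Lines/eisenstein-resource-bdp-line-lead-g10.md` §2, ADDENDUM 2.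
-/

set_option autoImplicit false
-- summit-side namespace `Summit.BirchSwinnertonDyer.BirchSwinnertonDyer.…` (single-conjunct summit, D-0017 layout)
set_option linter.dupNamespace false

noncomputable section

open scoped Classical
open NumberField WeierstrassCurve DirichletCharacter Literature.NumberTheory.LFunctions
  Literature.NumberTheory.EllipticCurves Literature.NumberTheory.EllipticCurves.KrizLi2019
  Literature.NumberTheory.EllipticCurves.Rank1Residual
open Literature.NumberTheory.Congruences
open Literature.NumberTheory.Automorphic.Brandt (norm_lt_one_iff_le_inv)

namespace Summit.BirchSwinnertonDyer.BirchSwinnertonDyer.Theorems.PrintCFram.KummerDictionary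

open Summit.BirchSwinnertonDyer.BirchSwinnertonDyer.Theorems.PrintCFram
open Summit.BirchSwinnertonDyer.Rank1Residual.X12.O11

variable {p : ℕ} [hp : Fact p.Prime]

/-! ## §1 Values of `ψ⁻¹` and of `ψ₀ω⁻¹` for a general `ψ` -/

section Values

variable {f m d : ℕ} [NeZero f] [NeZero m] [NeZero d]

omit [NeZero f] [NeZero m] in
/-- **`ψ(ℓ) = χ(ℓ)ω(ℓ)^k ⟹ ψ⁻¹(ℓ) = χ⁻¹(ℓ)ω(ℓ)^{p−1−k}`** at `p ∤ ℓ`, `k ≤ p − 1` (`ω(ℓ)^{p−1} = 1`).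
[cite: Washington1997, §5.1 (ω(a)^{p−1} = 1)] -/
theorem inv_apply_eq_of_apply_eq (ψ : DirichletCharacter ℚ_[p] f) (χ : DirichletCharacter ℚ_[p] m)
    (ω : DirichletCharacter ℚ_[p] p) {k ℓ : ℕ} (hkp : k ≤ p - 1) (hℓp : ¬ p ∣ ℓ)
    (h : ψ (ℓ : ZMod f) = χ (ℓ : ZMod m) * ω (ℓ : ZMod p) ^ k) :
    ψ⁻¹ (ℓ : ZMod f) = χ⁻¹ (ℓ : ZMod m) * ω (ℓ : ZMod p) ^ (p - 1 - k) := by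
  rw [MulChar.inv_apply_eq_inv', h, mul_inv, ← MulChar.inv_apply_eq_inv']
  congr 1
  have hω1 : ω (ℓ : ZMod p) ^ (p - 1) = 1 := by
    have h1 := apply_pow_sub_one_eq_one ω (ℓ : ℤ) (by exact_mod_cast hℓp)
    rwa [Int.cast_natCast] at h1
  refine inv_eq_of_mul_eq_one_right ?_
  rw [← pow_add, show k + (p - 1 - k) = p - 1 by omega, hω1]

omit [NeZero m] in
/-- **`(ψ₀ω⁻¹)(ℓ) = ψ(ℓ)·ε_K(ℓ)·ω(ℓ)⁻¹`** at every `ℓ` prime to `f·d·p`, for `ψ` ODD (so `ψ₀ = ψε_K` and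
`bernoulliCharTwo ψ εK ω = (ψ↑ε_K↑)↑·(ω⁻¹)↑`, w2 g4 `RegularLocusBernoulliPair.bernoulliCharTwo_of_not_even`).
[cite: KrizLi2019, §1.5 (p. 7, ψ₀) and Thm. 1.20 (p. 8)] -/
theorem bernoulliCharTwo_apply_natCast_of_coprime (ψ : DirichletCharacter ℚ_[p] f) (εK : DirichletCharacter ℚ_[p] d)
    (ω : DirichletCharacter ℚ_[p] p) (hodd : ¬ ψ.Even) {ℓ : ℕ} (hℓ : ℓ.Coprime (f * d * p)) :
    bernoulliCharTwo ψ εK ω (ℓ : ZMod (f * d * p)) = ψ (ℓ : ZMod f) * εK (ℓ : ZMod d) * (ω (ℓ : ZMod p))⁻¹ := by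
  have hℓfd : ℓ.Coprime (f * d) := Nat.Coprime.coprime_mul_right_right hℓ
  rw [RegularLocusBernoulliPair.bernoulliCharTwo_of_not_even ψ εK ω hodd, MulChar.mul_apply,
    EisensteinPair.changeLevel_apply_natCast _ _ hℓ, EisensteinPair.changeLevel_apply_natCast _ _ hℓ, MulChar.mul_apply,
    EisensteinPair.changeLevel_apply_natCast _ _ hℓfd, EisensteinPair.changeLevel_apply_natCast _ _ hℓfd,
    MulChar.inv_apply_eq_inv']

omit [NeZero m] in
/-- **`ψ(ℓ) = χ(ℓ)ω(ℓ)^k ⟹ (ψ₀ω⁻¹)(ℓ) = χ(ℓ)ε_K(ℓ)ω(ℓ)^{k−1}`** (`k ≠ 0`, `ℓ` prime to `f·d·p`; `ω(ℓ)` is a unit since its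
values at integers prime to `p` are roots of unity). [cite: KrizLi2019, Thm. 1.20 (p. 8)] -/
theorem bernoulliCharTwo_apply_eq_of_apply_eq (ψ : DirichletCharacter ℚ_[p] f)
    (χ : DirichletCharacter ℚ_[p] m) (εK : DirichletCharacter ℚ_[p] d) (ω : DirichletCharacter ℚ_[p] p)
    (hodd : ¬ ψ.Even) {k ℓ : ℕ} (hk0 : k ≠ 0) (hℓ : ℓ.Coprime (f * d * p))
    (h : ψ (ℓ : ZMod f) = χ (ℓ : ZMod m) * ω (ℓ : ZMod p) ^ k) :
    bernoulliCharTwo ψ εK ω (ℓ : ZMod (f * d * p)) = χ (ℓ : ZMod m) * εK (ℓ : ZMod d) * ω (ℓ : ZMod p) ^ (k - 1) := by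
  have hℓp : ℓ.Coprime p := Nat.Coprime.coprime_mul_left_right hℓ
  have hℓp' : ¬ p ∣ ℓ := fun h' ↦ hp.out.ne_one (Nat.Coprime.eq_one_of_dvd (Nat.coprime_comm.mp hℓp) h')
  rw [bernoulliCharTwo_apply_natCast_of_coprime ψ εK ω hodd hℓ, h]
  have hω0 : ω (ℓ : ZMod p) ≠ 0 := teichmuller_apply_ne_zero ω hℓp'
  have e : ω (ℓ : ZMod p) ^ k = ω (ℓ : ZMod p) ^ (k - 1) * ω (ℓ : ZMod p) := by
    rw [← pow_succ, Nat.sub_add_cancel (Nat.pos_of_ne_zero hk0)]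
  have hinv : ω (ℓ : ZMod p) * (ω (ℓ : ZMod p))⁻¹ = 1 := mul_inv_cancel₀ hω0
  rw [e]
  linear_combination (χ (ℓ : ZMod m) * εK (ℓ : ZMod d) * ω (ℓ : ZMod p) ^ (k - 1)) * hinv

end Values

/-! ## §2 Every odd datum with the trace form agrees with the class character -/

section Agreement

variable (W : WeierstrassCurve ℚ) [W.IsElliptic]

/-- **EVERY odd `ψ` with the trace form is the class character at the units.** Let `(m, χ, ε, k)` be class data for `W` at `p`
(`χ` primitive quadratic mod `m ⊥ p` with integer values `ε`, `2 ≤ k ≤ p − 2`, `χ(−1)(−1)^k = −1`, trace form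
`a_ℓ(W) ≡ ε(ℓ)(ℓ^k + ℓ^{p−k})` at every prime `ℓ ≠ p`, good reduction at `ℓ ∤ pm` — the output of
`KrizLiBinders.exists_krizLiData_of_cmRamified`), `ω` Teichmüller, and `(f, ψ)` ANY odd datum with `hss` for `W`. Then
`ψ(ℓ) = χ(ℓ)·ω(ℓ)^k` for every `ℓ ∈ ℕ` prime to `p·m·f·p`. Proof: both `ψ` and `ψ_c = χ↑(ω^k)↑` have `hss`, so
(`EisensteinPair.eq_or_eq_of_traceForm_congr`) `ψ↑ = ψ_c↑` or `ψ↑ = ψ_c⁻¹↑·ω↑` at level `p·m·f·p`; the second is impossible at `−1`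
(`ψ`, `ψ_c`, `ω` odd). [cite: KrizLi2019, §7.1 (p. 43, «interchange ψ and ψ⁻¹ω») and §2 (p. 11)] -/
theorem psi_apply_eq_classCharacter_of_hss (h5 : 5 ≤ p) {m : ℕ} [NeZero m]
    (χ : DirichletCharacter ℚ_[p] m) (hχ : χ.IsPrimitive) (hχq : χ.IsQuadratic) (hmp : m.Coprime p)
    (ε : ℕ → ℤ) (hε : ∀ ℓ : ℕ, ℓ.Prime → ℓ ≠ p → χ (ℓ : ZMod m) = (ε ℓ : ℚ_[p]))
    {k : ℕ} (hk2 : 2 ≤ k) (hkp : k ≤ p - 2) (hpar : χ (-1) * (-1) ^ k = -1)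
    (htr : ∀ ℓ : ℕ, ℓ.Prime → ℓ ≠ p →
      ((W.LFunction ℓ : ℤ) : ZMod p) = (ε ℓ : ZMod p) * ((ℓ : ZMod p) ^ k + (ℓ : ZMod p) ^ (p - k)))
    (hgoodW : ∀ ℓ : ℕ, (hℓ : ℓ.Prime) → ℓ ≠ p → ¬ ℓ ∣ m → (haveI := Fact.mk hℓ; W.HasGoodReductionAtPrime ℓ))
    (ω : DirichletCharacter ℚ_[p] p) (hω : IsTeichmullerCharacter ω)
    {f : ℕ} [NeZero f] (ψ : DirichletCharacter ℚ_[p] f) (hψ : ψ.Odd)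
    (hss : ∀ ℓ : ℕ, ℓ.Prime → ¬ (ℓ ∣ p * W.conductorNorm ℤ) →
      ‖((W.LFunction ℓ : ℤ) : ℚ_[p]) - (ψ (ℓ : ZMod f) + ψ⁻¹ (ℓ : ZMod f) * ω (ℓ : ZMod p))‖ < 1)
    {ℓ : ℕ} (hℓ : ℓ.Coprime (p * m * f * p)) :
    ψ (ℓ : ZMod f) = χ (ℓ : ZMod m) * ω (ℓ : ZMod p) ^ k := by
  have hpp := hp.out
  have hp2 : p ≠ 2 := by omega
  haveI : NeZero (p * m) := ⟨Nat.mul_ne_zero hpp.ne_zero (NeZero.ne m)⟩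
  obtain ⟨-, hssc, -, -⟩ := KrizLiBinders.krizLiBinders_of_data hp2 W χ hχ hχq hmp ε hε hk2 hkp htr hgoodW ω hω
  set ψc : DirichletCharacter ℚ_[p] (p * m) :=
    changeLevel (dvd_mul_left m p) χ * changeLevel (dvd_mul_right p m) (ω ^ k) with hψc
  have hψc_odd : ψc.Odd := KrizLiBinders.psi_odd_of ω χ k hp2 hω (by omega) hpar
  have hωodd : ω.Odd := KrizLiBinders.teichmuller_apply_neg_one hp2 hω
  -- the disjunction `ψ↑ = ψc↑ ∨ ψ↑ = ψc⁻¹↑ ω↑` at level `(p m) f p`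
  haveI : NeZero (p * m * f * p) := inferInstance
  have h₁ : p * m ∣ p * m * f * p := dvd_mul_of_dvd_left (dvd_mul_right (p * m) f) p
  have h₂ : f ∣ p * m * f * p := dvd_mul_of_dvd_left (dvd_mul_left f (p * m)) p
  have hpM : p ∣ p * m * f * p := dvd_mul_left p (p * m * f)
  have hN : p * W.conductorNorm ℤ ≠ 0 := Nat.mul_ne_zero hpp.ne_zero W.conductorNorm_pos_holds.ne'
  have e := EisensteinPair.eq_or_eq_of_traceForm_congr hp2 h₁ h₂ hpM ψc ψ ω hN
    (EisensteinPair.traceForm_congr_of_hss W ψc ψ ω hssc hss)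
  rcases e with e | e
  · -- `ψ↑ = ψc↑`: read at the unit `ℓ`
    have hℓpm : ℓ.Coprime (p * m) := Nat.Coprime.coprime_dvd_right h₁ hℓ
    have hv := DFunLike.congr_fun e (ℓ : ZMod (p * m * f * p))
    rw [EisensteinPair.changeLevel_apply_natCast h₂ ψ hℓ, EisensteinPair.changeLevel_apply_natCast h₁ ψc hℓ, hψc,
      KrizLiBinders.psi_apply_natCast_of_coprime ω χ k (by omega) hℓpm] at hv
    exact hv
  · -- `ψ↑ = ψc⁻¹↑ ω↑` contradicts parity at `−1`
    exfalso
    have hv := DFunLike.congr_fun e (-1 : ZMod (p * m * f * p))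
    rw [MulChar.mul_apply, EisensteinPair.changeLevel_apply_neg_one, EisensteinPair.changeLevel_apply_neg_one,
      EisensteinPair.changeLevel_apply_neg_one, MulChar.inv_apply_eq_inv',
      show ψ (-1) = -1 from hψ, show ψc (-1) = -1 from hψc_odd, show ω (-1) = -1 from hωodd] at hv
    norm_num at hv

/-- **Existential form on the crux's binders.** For `W/ℚ` elliptic with CM, `p ≥ 5` CM-ramified, `ω` Teichmüller and ANY odd
`(f, ψ)` with `hss`: there are class data `(m, χ, ε, k)` as in `KrizLiBinders.exists_krizLiData_of_cmRamified` (`χ` primitive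
quadratic mod `m ⊥ p`, `k ∈ {(p+1)/4, (3p−1)/4}`, `2 ≤ k ≤ p−2`, `χ(−1)(−1)^k = −1`, trace form) with
`ψ(ℓ) = χ(ℓ)ω(ℓ)^k` at every `ℓ` prime to `p·m·f·p`. [cite: KrizLi2019, §7.1 (p. 43) and Thm. 1.20 (p. 8)] [cite: BuhlerGross1985, Ch. I (4.3) (p. 14)] -/
theorem exists_classData_apply_eq_of_hss (hCM : W.HasCM) (hram : CMRamified W p) (h5 : 5 ≤ p)
    (ω : DirichletCharacter ℚ_[p] p) (hω : IsTeichmullerCharacter ω)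
    {f : ℕ} [NeZero f] (ψ : DirichletCharacter ℚ_[p] f) (hψ : ψ.Odd)
    (hss : ∀ ℓ : ℕ, ℓ.Prime → ¬ (ℓ ∣ p * W.conductorNorm ℤ) →
      ‖((W.LFunction ℓ : ℤ) : ℚ_[p]) - (ψ (ℓ : ZMod f) + ψ⁻¹ (ℓ : ZMod f) * ω (ℓ : ZMod p))‖ < 1) :
    ∃ (m : ℕ) (_ : NeZero m) (χ : DirichletCharacter ℚ_[p] m) (ε : ℕ → ℤ) (k : ℕ),
      m.Coprime p ∧ χ.IsPrimitive ∧ χ.IsQuadratic ∧ (∀ a : ℕ, χ (a : ZMod m) = (ε a : ℚ_[p])) ∧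
      (k = (p + 1) / 4 ∨ k = (3 * p - 1) / 4) ∧ 2 ≤ k ∧ k ≤ p - 2 ∧ χ (-1) * (-1) ^ k = -1 ∧
      (∀ ℓ : ℕ, ℓ.Prime → ℓ ≠ p →
        ((W.LFunction ℓ : ℤ) : ZMod p) = (ε ℓ : ZMod p) * ((ℓ : ZMod p) ^ k + (ℓ : ZMod p) ^ (p - k))) ∧
      ∀ ℓ : ℕ, ℓ.Coprime (p * m * f * p) → ψ (ℓ : ZMod f) = χ (ℓ : ZMod m) * ω (ℓ : ZMod p) ^ k := by
  obtain ⟨m, hm, χ, ε, k, hmp, hχ, hχq, hε, hk, hk2, hkp, hpar, htr, hgoodW⟩ :=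
    KrizLiBinders.exists_krizLiData_of_cmRamified W hCM hram h5
  haveI := hm
  exact ⟨m, hm, χ, ε, k, hmp, hχ, hχq, hε, hk, hk2, hkp, hpar, htr, fun ℓ hℓ ↦
    psi_apply_eq_classCharacter_of_hss W h5 χ hχ hχq hmp ε (fun ℓ _ _ ↦ hε ℓ) hk2 hkp hpar htr hgoodW ω hω ψ hψ hss hℓ⟩

end Agreement

/-! ## §3 The dictionary for every odd datum with the trace form -/

section OnBinders

variable (W : WeierstrassCurve ℚ) [W.IsElliptic] {m : ℕ} [hm : NeZero m]
  (χ : DirichletCharacter ℚ_[p] m) (ε : ℕ → ℤ) (k : ℕ) (ω : DirichletCharacter ℚ_[p] p)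
  {f : ℕ} [hf : NeZero f] (ψ : DirichletCharacter ℚ_[p] f)

/-- **B1's premise on the binders: `‖bernoulliOnePrim ψ⁻¹‖ ≤ p⁻¹ ⟺ ‖B_{p−k,χ}/(p−k)‖ ≤ p⁻¹`** for every odd `(f, ψ, ω)` with
`hss`, `(m, χ, ε, k)` class data of `W` as in §2 (`χ` quadratic, so `χ⁻¹ = χ`). [cite: KrizLi2019, Thm. 1.20 (p. 8, the Bernoulli hypothesis)] [cite: Washington1997, Thm. 5.11 and Cor. 5.13] -/
theorem norm_bernoulliOnePrim_inv_le_inv_iff_of_hss (h5 : 5 ≤ p)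
    (hχ : χ.IsPrimitive) (hχq : χ.IsQuadratic) (hmp : m.Coprime p)
    (hε : ∀ ℓ : ℕ, ℓ.Prime → ℓ ≠ p → χ (ℓ : ZMod m) = (ε ℓ : ℚ_[p]))
    (hk2 : 2 ≤ k) (hkp : k ≤ p - 2) (hpar : χ (-1) * (-1) ^ k = -1)
    (htr : ∀ ℓ : ℕ, ℓ.Prime → ℓ ≠ p →
      ((W.LFunction ℓ : ℤ) : ZMod p) = (ε ℓ : ZMod p) * ((ℓ : ZMod p) ^ k + (ℓ : ZMod p) ^ (p - k)))
    (hgoodW : ∀ ℓ : ℕ, (hℓ : ℓ.Prime) → ℓ ≠ p → ¬ ℓ ∣ m → (haveI := Fact.mk hℓ; W.HasGoodReductionAtPrime ℓ))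
    (hω : IsTeichmullerCharacter ω) (hψ : ψ.Odd)
    (hss : ∀ ℓ : ℕ, ℓ.Prime → ¬ (ℓ ∣ p * W.conductorNorm ℤ) →
      ‖((W.LFunction ℓ : ℤ) : ℚ_[p]) - (ψ (ℓ : ZMod f) + ψ⁻¹ (ℓ : ZMod f) * ω (ℓ : ZMod p))‖ < 1) :
    ‖bernoulliOnePrim ψ⁻¹‖ ≤ (p : ℝ)⁻¹ ↔
      ‖((p - k : ℕ) : ℚ_[p])⁻¹ * generalizedBernoulli (p - k) χ‖ ≤ (p : ℝ)⁻¹ := by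
  have hpp := hp.out
  have hN₀ : p * m * f * p ≠ 0 :=
    Nat.mul_ne_zero (Nat.mul_ne_zero (Nat.mul_ne_zero hpp.ne_zero hm.out) hf.out) hpp.ne_zero
  have hχ' : χ⁻¹.IsPrimitive := by rw [isPrimitive_def, conductor_inv]; exact hχ
  have h := norm_bernoulliOnePrim_le_inv_iff_of_values hmp χ⁻¹ hχ' hω (j := p - 1 - k) (by omega) (by omega)
    (Ψ := ψ⁻¹) (N₀ := p * m * f * p) hN₀ (fun ℓ hℓ hℓN ↦ by
      have hcop : ℓ.Coprime (p * m * f * p) := (Nat.Prime.coprime_iff_not_dvd hℓ).mpr hℓN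
      have hℓp0 : ℓ.Coprime p := Nat.Coprime.coprime_mul_left_right hcop
      have hℓp : ¬ p ∣ ℓ := fun h' ↦ hpp.ne_one (Nat.Coprime.eq_one_of_dvd (Nat.coprime_comm.mp hℓp0) h')
      exact inv_apply_eq_of_apply_eq ψ χ ω (by omega) hℓp
        (psi_apply_eq_classCharacter_of_hss W h5 χ hχ hχq hmp ε hε hk2 hkp hpar htr hgoodW ω hω ψ hψ hss hcop))
  have e : p - 1 - k + 1 = p - k := by omega
  rw [e, hχq.inv] at h
  exact h

/-- **B2′'s premise on the binders, at one field: `‖bernoulliOnePrim (bernoulliCharTwo ψ εK ω)‖ ≤ p⁻¹ ⟺ ‖B_{k,χε}/k‖ ≤ p⁻¹`** for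
every odd `(f, ψ, ω)` with `hss`, `ε_K` mod `d`, and any PRIMITIVE `χε` of level `c ⊥ p` with `χε(ℓ) = χ(ℓ)ε_K(ℓ)` at all primes
off a finite set. [cite: KrizLi2019, Thm. 1.20 (p. 8, the Bernoulli hypothesis)] [cite: Washington1997, Thm. 5.11 and Cor. 5.13] -/
theorem norm_bernoulliOnePrim_bernoulliCharTwo_le_inv_iff_of_hss (h5 : 5 ≤ p)
    (hχ : χ.IsPrimitive) (hχq : χ.IsQuadratic) (hmp : m.Coprime p)
    (hε : ∀ ℓ : ℕ, ℓ.Prime → ℓ ≠ p → χ (ℓ : ZMod m) = (ε ℓ : ℚ_[p]))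
    (hk2 : 2 ≤ k) (hkp : k ≤ p - 2) (hpar : χ (-1) * (-1) ^ k = -1)
    (htr : ∀ ℓ : ℕ, ℓ.Prime → ℓ ≠ p →
      ((W.LFunction ℓ : ℤ) : ZMod p) = (ε ℓ : ZMod p) * ((ℓ : ZMod p) ^ k + (ℓ : ZMod p) ^ (p - k)))
    (hgoodW : ∀ ℓ : ℕ, (hℓ : ℓ.Prime) → ℓ ≠ p → ¬ ℓ ∣ m → (haveI := Fact.mk hℓ; W.HasGoodReductionAtPrime ℓ))
    (hω : IsTeichmullerCharacter ω) (hψ : ψ.Odd)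
    (hss : ∀ ℓ : ℕ, ℓ.Prime → ¬ (ℓ ∣ p * W.conductorNorm ℤ) →
      ‖((W.LFunction ℓ : ℤ) : ℚ_[p]) - (ψ (ℓ : ZMod f) + ψ⁻¹ (ℓ : ZMod f) * ω (ℓ : ZMod p))‖ < 1)
    {d : ℕ} [hd : NeZero d] (εK : DirichletCharacter ℚ_[p] d)
    {c : ℕ} [NeZero c] (hcp : c.Coprime p) (χε : DirichletCharacter ℚ_[p] c) (hχε : χε.IsPrimitive) {N₁ : ℕ} (hN₁ : N₁ ≠ 0)
    (hval : ∀ ℓ : ℕ, ℓ.Prime → ¬ ℓ ∣ N₁ → χε (ℓ : ZMod c) = χ (ℓ : ZMod m) * εK (ℓ : ZMod d)) :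
    ‖bernoulliOnePrim (bernoulliCharTwo ψ εK ω)‖ ≤ (p : ℝ)⁻¹ ↔
      ‖(k : ℚ_[p])⁻¹ * generalizedBernoulli k χε‖ ≤ (p : ℝ)⁻¹ := by
  have hpp := hp.out
  have hne : ¬ ψ.Even := EisensteinPair.not_even_of_odd' ψ hψ
  have hN₀ : N₁ * (p * m * f * p * d) ≠ 0 :=
    Nat.mul_ne_zero hN₁ (Nat.mul_ne_zero
      (Nat.mul_ne_zero (Nat.mul_ne_zero (Nat.mul_ne_zero hpp.ne_zero hm.out) hf.out) hpp.ne_zero) hd.out)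
  have h := norm_bernoulliOnePrim_le_inv_iff_of_values hcp χε hχε hω (j := k - 1) (by omega) (by omega)
    (Ψ := bernoulliCharTwo ψ εK ω) (N₀ := N₁ * (p * m * f * p * d)) hN₀ (fun ℓ hℓ hℓN ↦ by
      have hℓN₁ : ¬ ℓ ∣ N₁ := fun h' ↦ hℓN (h'.mul_right _)
      have hℓL : ¬ ℓ ∣ p * m * f * p * d := fun h' ↦ hℓN (h'.mul_left _)
      have hcopL : ℓ.Coprime (p * m * f * p * d) := (Nat.Prime.coprime_iff_not_dvd hℓ).mpr hℓL
      have hcop : ℓ.Coprime (p * m * f * p) := Nat.Coprime.coprime_mul_right_right hcopL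
      have hℓd : ℓ.Coprime d := Nat.Coprime.coprime_mul_left_right hcopL
      have hℓf : ℓ.Coprime f := Nat.Coprime.coprime_dvd_right
        (dvd_mul_of_dvd_left (dvd_mul_left f (p * m)) p) hcop
      have hℓp : ℓ.Coprime p := Nat.Coprime.coprime_dvd_right (dvd_mul_left p (p * m * f)) hcop
      have hfdp : ℓ.Coprime (f * d * p) := Nat.Coprime.mul_right (Nat.Coprime.mul_right hℓf hℓd) hℓp
      rw [bernoulliCharTwo_apply_eq_of_apply_eq ψ χ εK ω hne (by omega) hfdp
        (psi_apply_eq_classCharacter_of_hss W h5 χ hχ hχq hmp ε hε hk2 hkp hpar htr hgoodW ω hω ψ hψ hss hcop),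
        hval ℓ hℓ hℓN₁])
  have e : k - 1 + 1 = k := by omega
  rw [e] at h
  exact h

/-- **B2′'s premise at an imaginary quadratic `K''` Heegner for `N_W`** (the B2′ binder shape): for `W` with CM, `p ≥ 5`
CM-ramified (so `p ∣ N_W` and `p ∤ d_{K''}`), class data `(m, χ, ε, k)`, any odd `(f, ψ, ω)` with `hss`, `K''` imaginary quadratic
with the Heegner hypothesis for `N_W`, `ε_K` a Kronecker character of `K''`:
`‖B_{1,(ψε_Kω⁻¹)~}‖ ≤ p⁻¹ ⟺ ‖B_{k,(χ↑ε_K↑)~}/k‖ ≤ p⁻¹`, the primitive character `(χ↑ε_K↑)~` being the quadratic character of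
`e·d_{K''}`. [cite: KrizLi2019, Thm. 1.20 (p. 8)] [cite: GrossLMS1991, §1 (p. 235, Heegner hypothesis)] [cite: Washington1997, Thm. 5.11 and Cor. 5.13] -/
theorem norm_bernoulliOnePrim_bernoulliCharTwo_le_inv_iff_of_heegner [W.IsGloballyMinimal] (hCM : W.HasCM)
    (hram : CMRamified W p) (h5 : 5 ≤ p)
    (hχ : χ.IsPrimitive) (hχq : χ.IsQuadratic) (hmp : m.Coprime p)
    (hε : ∀ ℓ : ℕ, ℓ.Prime → ℓ ≠ p → χ (ℓ : ZMod m) = (ε ℓ : ℚ_[p]))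
    (hk2 : 2 ≤ k) (hkp : k ≤ p - 2) (hpar : χ (-1) * (-1) ^ k = -1)
    (htr : ∀ ℓ : ℕ, ℓ.Prime → ℓ ≠ p →
      ((W.LFunction ℓ : ℤ) : ZMod p) = (ε ℓ : ZMod p) * ((ℓ : ZMod p) ^ k + (ℓ : ZMod p) ^ (p - k)))
    (hgoodW : ∀ ℓ : ℕ, (hℓ : ℓ.Prime) → ℓ ≠ p → ¬ ℓ ∣ m → (haveI := Fact.mk hℓ; W.HasGoodReductionAtPrime ℓ))
    (hω : IsTeichmullerCharacter ω) (hψ : ψ.Odd)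
    (hss : ∀ ℓ : ℕ, ℓ.Prime → ¬ (ℓ ∣ p * W.conductorNorm ℤ) →
      ‖((W.LFunction ℓ : ℤ) : ℚ_[p]) - (ψ (ℓ : ZMod f) + ψ⁻¹ (ℓ : ZMod f) * ω (ℓ : ZMod p))‖ < 1)
    (K : Type) [Field K] [NumberField K] (hK : IsImaginaryQuadratic K)
    (hH : SatisfiesHeegnerHypothesis (W.conductorNorm ℤ) K)
    (εK : DirichletCharacter ℚ_[p] (NumberField.discr K).natAbs) :
    haveI : NeZero (NumberField.discr K).natAbs := ⟨Int.natAbs_ne_zero.mpr (NumberField.discr_ne_zero K)⟩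
    ‖bernoulliOnePrim (bernoulliCharTwo ψ εK ω)‖ ≤ (p : ℝ)⁻¹ ↔
      ‖(k : ℚ_[p])⁻¹ * @generalizedBernoulli ℚ_[p] _ _
          (changeLevel (dvd_mul_right m (NumberField.discr K).natAbs) χ *
            changeLevel (dvd_mul_left (NumberField.discr K).natAbs m) εK).conductor
          ⟨conductor_ne_zero _⟩ k
          (changeLevel (dvd_mul_right m (NumberField.discr K).natAbs) χ *
            changeLevel (dvd_mul_left (NumberField.discr K).natAbs m) εK).primitiveCharacter‖ ≤ (p : ℝ)⁻¹ := by
  have hpp := hp.out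
  haveI : NeZero (NumberField.discr K).natAbs := ⟨Int.natAbs_ne_zero.mpr (NumberField.discr_ne_zero K)⟩
  -- `p ∤ d_{K''}`: the CM-ramified `p` divides `N_W`, hence splits in `K''`
  have hpd : ¬ p ∣ (NumberField.discr K).natAbs := by
    rw [← Int.natCast_dvd]
    exact Literature.SatisfiesHeegnerHypothesis.not_dvd_discr hK.1 hH hpp
      (BorelTorsion.dvd_conductorNorm_of_cmRamified W p hCM hram)
  have hdp : (NumberField.discr K).natAbs.Coprime p := ((Nat.Prime.coprime_iff_not_dvd hpp).mpr hpd).symm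
  haveI : NeZero (changeLevel (dvd_mul_right m (NumberField.discr K).natAbs) χ *
      changeLevel (dvd_mul_left (NumberField.discr K).natAbs m) εK).conductor := ⟨conductor_ne_zero _⟩
  have hc : (changeLevel (dvd_mul_right m (NumberField.discr K).natAbs) χ *
      changeLevel (dvd_mul_left (NumberField.discr K).natAbs m) εK).conductor.Coprime p :=
    Nat.Coprime.coprime_dvd_left (conductor_dvd_level _) (Nat.Coprime.mul_left hmp hdp)
  refine norm_bernoulliOnePrim_bernoulliCharTwo_le_inv_iff_of_hss W χ ε k ω ψ h5 hχ hχq hmp hε hk2 hkp hpar htr hgoodW hω hψ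
    hss εK hc _ (primitiveCharacter_isPrimitive _) (N₁ := m * (NumberField.discr K).natAbs)
    (Nat.mul_ne_zero hm.out (NeZero.ne _)) fun ℓ hℓ hℓN ↦ ?_
  have hcop : IsCoprime (ℓ : ℤ) ((m * (NumberField.discr K).natAbs : ℕ) : ℤ) :=
    Nat.isCoprime_iff_coprime.mpr ((Nat.Prime.coprime_iff_not_dvd hℓ).mpr hℓN)
  have h := primitiveCharacter_apply_of_isCoprime
    (changeLevel (dvd_mul_right m (NumberField.discr K).natAbs) χ *
      changeLevel (dvd_mul_left (NumberField.discr K).natAbs m) εK) hcop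
  rw [Int.cast_natCast, Int.cast_natCast] at h
  rw [h, CharacterTwist.changeLevel_mul_changeLevel_apply_natCast]

end OnBinders

end Summit.BirchSwinnertonDyer.BirchSwinnertonDyer.Theorems.PrintCFram.KummerDictionary

end
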